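import Summits.CriticalPhenomena.CardyFormulaZ2.Theorems.ModulusResponseSmirnovCellAnchorLowerDet
import Summits.CriticalPhenomena.CardyFormulaZ2.Theorems.ModulusResponseSmirnovCellAnchorUpperDet
import Summits.CriticalPhenomena.CardyFormulaZ2.Theorems.ModulusResponseSmirnovCellAnchorCellLaw
import Literature.Probability.LatticeModels.TriangularLatticeReflection
import Literature.Probability.Percolation.SmirnovReflection

/-!
# The cell/site sandwich, probability forms, for both orientations (support item `SmirnovCellAnchor`)

Helper file for `Summit.CriticalPhenomena.CardyFormulaZ2.Theses.ModulusResponse.SmirnovCellAnchor`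
(stmt-CriticalPhenomena-6471). From the deterministic halves (`…LowerDet`, `…UpperDet`) we derive
the probability forms in the shape of the tree's `real_pathIn_le_triCrossingProb` /
`triCrossingProb_le_real_not_pathIn` (Bollobás–Riordan 2006, Ch. 7, Claim 20 p. 192 and remark
p. 195), with G02's `𝕋` crossing probability replaced by the cell crossing probability
`P^{site}_p {X | Φ X ∈ discreteCrossing Q δ (Q.arc 0) (Q.arc 2)}` of the `ℤ²` recipe:
`real_pathIn_le_cell`, `cell_le_real_not_pathIn` (sites read in the frame of `W = g(Q)`).
Since the discrete approximations of the tree are available for anticlockwise boundaries only, we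
also record the same two statements for site sets placed relative to the **conjugate** rectangle
`W.conjugate` (`real_pathIn_le_cell_conj`, `cell_le_real_not_pathIn_conj`), obtained through the
lattice reflection `triConj` realising complex conjugation and the relabelling invariance of site
percolation.
-/

noncomputable section

namespace Summit.CriticalPhenomena.CardyFormulaZ2.Theorems.SmirnovCellAnchor

open Set Metric MeasureTheory
open Literature.Probability.Percolation Literature.Probability.LatticeModels
  Literature.Probability.RandomPlanarGeometry
open scoped ComplexConjugate

/-! ### Direct orientation -/

section Direct

variable (Φ : Set (Site 2) → BondConfig (Site 2))
  (hΦ : ∀ X, Φ X = {e | ∃ m ∈ X, e = s(m - Pi.single 0 1, m) ∨ e = s(m - Pi.single 1 1, m)})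
  (g : ℂ → ℂ) (hg : ∀ z, g z = (z.re : ℂ) + (z.im : ℂ) * triZeta)
  (Q W : ConformalRectangle) (hW : W.carrier = g '' Q.carrier)
  (hWarc : ∀ i, W.arc i = g '' Q.arc i) (hWpt : ∀ j, W.pt j = g (Q.pt j))
include hΦ hg hW hWarc hWpt

/-- **Lower half, probability form**: for `ρ > 0` and all small `δ`, `t`, if `V` is a set of
sites `ρ`-off the marked points of `W` whose members off `W` are within `t` of `W.arc 0 ∪ W.arc 2`
and whose members in `W` are `8δ`-off `W.arc 1 ∪ W.arc 3`, and `U₀`, `U₂` are sets of sites off `W`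
within `t` of `W.arc 0`, `W.arc 2`, then the probability of an open `𝕋`-path inside `V` from `U₀`
to `U₂` is at most the cell crossing probability of `Q`, at every density.
[cite: BollobasRiordan2006, Ch. 7 Claim 20 p. 192 and remark p. 195] -/
theorem real_pathIn_le_cell {ρ : ℝ} (hρ : 0 < ρ) :
    ∃ δ₀ > 0, ∃ t₀ > 0, ∀ δ t : ℝ, 0 < δ → δ < δ₀ → 0 ≤ t → t ≤ t₀ →
      ∀ (p : unitInterval) (V U₀ U₂ : Set (Site 2)),
        (∀ x ∈ V, triMeshPoint δ x ∉ W.carrier →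
          infDist (triMeshPoint δ x) (W.arc 0) ≤ t ∨ infDist (triMeshPoint δ x) (W.arc 2) ≤ t) →
        (∀ x ∈ V, triMeshPoint δ x ∈ W.carrier →
          8 * δ < infDist (triMeshPoint δ x) (W.arc 1) ∧ 8 * δ < infDist (triMeshPoint δ x) (W.arc 3)) →
        (∀ x ∈ V, ∀ j : Fin 4, ρ ≤ dist (triMeshPoint δ x) (W.pt j)) →
        (∀ u ∈ U₀, triMeshPoint δ u ∉ W.carrier ∧ infDist (triMeshPoint δ u) (W.arc 0) ≤ t) →
        (∀ v ∈ U₂, triMeshPoint δ v ∉ W.carrier ∧ infDist (triMeshPoint δ v) (W.arc 2) ≤ t) →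
        (triSitePercolation p).real {ω | ∃ u ∈ U₀, ∃ v ∈ U₂, PathIn triGraph (V ∩ ω) u v} ≤
          (triSitePercolation p).real {ω | Φ ω ∈ discreteCrossing Q.carrier δ (Q.arc 0) (Q.arc 2)} := by
  obtain ⟨δ₀, hδ₀, t₀, ht₀, h⟩ := cell_mem_discreteCrossing_of_pathIn Φ hΦ g hg Q W hW hWarc hWpt hρ
  refine ⟨δ₀, hδ₀, t₀, ht₀, fun δ t hδ hδlt ht htle p V U₀ U₂ hout hin hcorner hU₀ hU₂ => ?_⟩
  refine measureReal_mono (μ := triSitePercolation p) ?_ (measure_ne_top _ _)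
  rintro ω ⟨u, hu, v, hv, hP⟩
  exact h δ t hδ hδlt ht htle ω (V ∩ ω) u v inter_subset_right (fun x hx => hout x hx.1)
    (fun x hx => hin x hx.1) (fun x hx => hcorner x hx.1) (hU₀ u hu).1 (hU₀ u hu).2 (hU₂ v hv).1
    (hU₂ v hv).2 hP

/-- **Upper half, probability form**: for `ρ > 0` and all small `δ`, `t`, if `V` is a set of sites
`ρ`-off the marked points of `W` whose members off `W` are within `t` of `W.arc 1 ∪ W.arc 3` and
whose members in `W` are `8δ`-off `W.arc 0 ∪ W.arc 2`, and `U₁`, `U₃` are sets of sites `4δ`-off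
`W` within `t` of `W.arc 1`, `W.arc 3`, then the cell crossing probability of `Q` is at most the
probability that there is **no** closed `𝕋`-path inside `V` from `U₁` to `U₃`, at every density.
[cite: BollobasRiordan2006, Ch. 7 Claim 20 p. 192 and remark p. 195] -/
theorem cell_le_real_not_pathIn {ρ : ℝ} (hρ : 0 < ρ) :
    ∃ δ₀ > 0, ∃ t₀ > 0, ∀ δ t : ℝ, 0 < δ → δ < δ₀ → 0 ≤ t → t ≤ t₀ →
      ∀ (p : unitInterval) (V U₁ U₃ : Set (Site 2)),
        (∀ x ∈ V, triMeshPoint δ x ∉ W.carrier →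
          infDist (triMeshPoint δ x) (W.arc 1) ≤ t ∨ infDist (triMeshPoint δ x) (W.arc 3) ≤ t) →
        (∀ x ∈ V, triMeshPoint δ x ∈ W.carrier →
          8 * δ < infDist (triMeshPoint δ x) (W.arc 0) ∧ 8 * δ < infDist (triMeshPoint δ x) (W.arc 2)) →
        (∀ x ∈ V, ∀ j : Fin 4, ρ ≤ dist (triMeshPoint δ x) (W.pt j)) →
        (∀ u ∈ U₁, 4 * δ ≤ infDist (triMeshPoint δ u) W.carrier ∧ infDist (triMeshPoint δ u) (W.arc 1) ≤ t) →
        (∀ v ∈ U₃, 4 * δ ≤ infDist (triMeshPoint δ v) W.carrier ∧ infDist (triMeshPoint δ v) (W.arc 3) ≤ t) →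
        (triSitePercolation p).real {ω | Φ ω ∈ discreteCrossing Q.carrier δ (Q.arc 0) (Q.arc 2)} ≤
          (triSitePercolation p).real {ω | ¬ ∃ u ∈ U₁, ∃ v ∈ U₃, PathIn triGraph (V ∩ ωᶜ) u v} := by
  obtain ⟨δ₀, hδ₀, t₀, ht₀, h⟩ := cell_not_mem_discreteCrossing_of_pathIn Φ hΦ g hg Q W hW hWarc hWpt hρ
  refine ⟨δ₀, hδ₀, t₀, ht₀, fun δ t hδ hδlt ht htle p V U₁ U₃ hout hin hcorner hU₁ hU₃ => ?_⟩
  refine measureReal_mono (μ := triSitePercolation p) ?_ (measure_ne_top _ _)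
  rintro ω hω ⟨u, hu, v, hv, hP⟩
  exact h δ t hδ hδlt ht htle ω (V ∩ ωᶜ) u v inter_subset_right (fun x hx => hout x hx.1)
    (fun x hx => hin x hx.1) (fun x hx => hcorner x hx.1) (hU₁ u hu).1 (hU₁ u hu).2 (hU₃ v hv).1
    (hU₃ v hv).2 hP hω

end Direct

/-! ### Transport of `𝕋`-paths under the lattice reflection -/

/-- A `𝕋`-path is carried to a `𝕋`-path by the reflection `triConj` (a graph automorphism).
[folklore] -/
theorem pathIn_image_triConjFun {A : Set (Site 2)} {u v : Site 2} (h : PathIn triGraph A u v) :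
    PathIn triGraph (triConjFun '' A) (triConjFun u) (triConjFun v) := by
  obtain ⟨hu, h⟩ := h
  refine ⟨mem_image_of_mem _ hu, ?_⟩
  induction h with
  | refl => exact Relation.ReflTransGen.refl
  | tail _ hbc ih => exact ih.tail ⟨(triGraph_adj_triConjFun_iff _ _).2 hbc.1, mem_image_of_mem _ hbc.2⟩

/-- The reflection commutes with intersections of site sets (it is injective). [folklore] -/
theorem image_triConjFun_inter (A B : Set (Site 2)) :
    triConjFun '' (A ∩ B) = triConjFun '' A ∩ triConjFun '' B :=
  image_inter triConj.injective

/-- The reflection commutes with complements of site sets (it is bijective). [folklore] -/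
theorem image_triConjFun_compl (A : Set (Site 2)) : triConjFun '' Aᶜ = (triConjFun '' A)ᶜ :=
  image_compl_eq triConj.bijective

/-- Positions of reflected sites relative to `W` are positions relative to `W.conjugate`:
membership. [folklore] -/
theorem triMeshPoint_triConjFun_mem_iff (W : ConformalRectangle) (δ : ℝ) (x : Site 2) :
    triMeshPoint δ (triConjFun x) ∈ W.carrier ↔ triMeshPoint δ x ∈ W.conjugate.carrier := by
  rw [triMeshPoint_triConjFun, MarkedDomain.conjugate_carrier, mem_conjSet]

/-- Positions of reflected sites relative to `W` are positions relative to `W.conjugate`: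
distances to arcs. [folklore] -/
theorem infDist_triMeshPoint_triConjFun_arc (W : ConformalRectangle) (δ : ℝ) (x : Site 2) (i : Fin 4) :
    infDist (triMeshPoint δ (triConjFun x)) (W.arc i) = infDist (triMeshPoint δ x) (W.conjugate.arc i) := by
  rw [triMeshPoint_triConjFun, MarkedDomain.conjugate_arc, infDist_conjSet]

/-- Positions of reflected sites relative to `W` are positions relative to `W.conjugate`:
distances to the carrier. [folklore] -/
theorem infDist_triMeshPoint_triConjFun_carrier (W : ConformalRectangle) (δ : ℝ) (x : Site 2) :
    infDist (triMeshPoint δ (triConjFun x)) W.carrier = infDist (triMeshPoint δ x) W.conjugate.carrier := by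
  rw [triMeshPoint_triConjFun, MarkedDomain.conjugate_carrier, infDist_conjSet]

/-- Positions of reflected sites relative to `W` are positions relative to `W.conjugate`:
distances to the marked points. [folklore] -/
theorem dist_triMeshPoint_triConjFun_pt (W : ConformalRectangle) (δ : ℝ) (x : Site 2) (j : Fin 4) :
    dist (triMeshPoint δ (triConjFun x)) (W.pt j) = dist (triMeshPoint δ x) (W.conjugate.pt j) := by
  rw [triMeshPoint_triConjFun, MarkedDomain.conjugate_pt, ← Complex.dist_conj_conj, Complex.conj_conj]

/-! ### Conjugate orientation -/

section Conj

variable (Φ : Set (Site 2) → BondConfig (Site 2))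
  (hΦ : ∀ X, Φ X = {e | ∃ m ∈ X, e = s(m - Pi.single 0 1, m) ∨ e = s(m - Pi.single 1 1, m)})
  (g : ℂ → ℂ) (hg : ∀ z, g z = (z.re : ℂ) + (z.im : ℂ) * triZeta)
  (Q W : ConformalRectangle) (hW : W.carrier = g '' Q.carrier)
  (hWarc : ∀ i, W.arc i = g '' Q.arc i) (hWpt : ∀ j, W.pt j = g (Q.pt j))
include hΦ hg hW hWarc hWpt

/-- **Lower half, probability form, for site sets placed relative to the conjugate rectangle.**
[cite: BollobasRiordan2006, Ch. 7 Claim 20 p. 192 and remark p. 195] -/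
theorem real_pathIn_le_cell_conj {ρ : ℝ} (hρ : 0 < ρ) :
    ∃ δ₀ > 0, ∃ t₀ > 0, ∀ δ t : ℝ, 0 < δ → δ < δ₀ → 0 ≤ t → t ≤ t₀ →
      ∀ (p : unitInterval) (V U₀ U₂ : Set (Site 2)),
        (∀ x ∈ V, triMeshPoint δ x ∉ W.conjugate.carrier →
          infDist (triMeshPoint δ x) (W.conjugate.arc 0) ≤ t ∨ infDist (triMeshPoint δ x) (W.conjugate.arc 2) ≤ t) →
        (∀ x ∈ V, triMeshPoint δ x ∈ W.conjugate.carrier →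
          8 * δ < infDist (triMeshPoint δ x) (W.conjugate.arc 1) ∧
            8 * δ < infDist (triMeshPoint δ x) (W.conjugate.arc 3)) →
        (∀ x ∈ V, ∀ j : Fin 4, ρ ≤ dist (triMeshPoint δ x) (W.conjugate.pt j)) →
        (∀ u ∈ U₀, triMeshPoint δ u ∉ W.conjugate.carrier ∧ infDist (triMeshPoint δ u) (W.conjugate.arc 0) ≤ t) →
        (∀ v ∈ U₂, triMeshPoint δ v ∉ W.conjugate.carrier ∧ infDist (triMeshPoint δ v) (W.conjugate.arc 2) ≤ t) →
        (triSitePercolation p).real {ω | ∃ u ∈ U₀, ∃ v ∈ U₂, PathIn triGraph (V ∩ ω) u v} ≤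
          (triSitePercolation p).real {ω | Φ ω ∈ discreteCrossing Q.carrier δ (Q.arc 0) (Q.arc 2)} := by
  obtain ⟨δ₀, hδ₀, t₀, ht₀, h⟩ := real_pathIn_le_cell Φ hΦ g hg Q W hW hWarc hWpt hρ
  refine ⟨δ₀, hδ₀, t₀, ht₀, fun δ t hδ hδlt ht htle p V U₀ U₂ hout hin hcorner hU₀ hU₂ => ?_⟩
  set E : Set (SiteConfig (Site 2)) := {ω | ∃ u ∈ triConjFun '' U₀, ∃ v ∈ triConjFun '' U₂,
    PathIn triGraph (triConjFun '' V ∩ ω) u v} with hE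
  have hsub : {ω : SiteConfig (Site 2) | ∃ u ∈ U₀, ∃ v ∈ U₂, PathIn triGraph (V ∩ ω) u v} ⊆
      {ω | triConj '' ω ∈ E} := by
    rintro ω ⟨u, hu, v, hv, hP⟩
    refine ⟨triConjFun u, mem_image_of_mem _ hu, triConjFun v, mem_image_of_mem _ hv, ?_⟩
    have := pathIn_image_triConjFun hP
    rwa [image_triConjFun_inter] at this
  have hE' : (triSitePercolation p).real E ≤
      (triSitePercolation p).real {ω | Φ ω ∈ discreteCrossing Q.carrier δ (Q.arc 0) (Q.arc 2)} := by
    refine h δ t hδ hδlt ht htle p (triConjFun '' V) (triConjFun '' U₀) (triConjFun '' U₂) ?_ ?_ ?_ ?_ ?_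
    · rintro _ ⟨x, hx, rfl⟩ hxW
      rw [infDist_triMeshPoint_triConjFun_arc W, infDist_triMeshPoint_triConjFun_arc W]
      exact hout x hx (fun h' => hxW ((triMeshPoint_triConjFun_mem_iff W δ x).2 h'))
    · rintro _ ⟨x, hx, rfl⟩ hxW
      rw [infDist_triMeshPoint_triConjFun_arc W, infDist_triMeshPoint_triConjFun_arc W]
      exact hin x hx ((triMeshPoint_triConjFun_mem_iff W δ x).1 hxW)
    · rintro _ ⟨x, hx, rfl⟩ j
      rw [dist_triMeshPoint_triConjFun_pt W]
      exact hcorner x hx j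
    · rintro _ ⟨u, hu, rfl⟩
      rw [triMeshPoint_triConjFun_mem_iff W, infDist_triMeshPoint_triConjFun_arc W]
      exact hU₀ u hu
    · rintro _ ⟨v, hv, rfl⟩
      rw [triMeshPoint_triConjFun_mem_iff W, infDist_triMeshPoint_triConjFun_arc W]
      exact hU₂ v hv
  calc (triSitePercolation p).real {ω | ∃ u ∈ U₀, ∃ v ∈ U₂, PathIn triGraph (V ∩ ω) u v}
      ≤ (triSitePercolation p).real {ω | triConj '' ω ∈ E} := measureReal_mono hsub (measure_ne_top _ _)
    _ = (triSitePercolation p).real E := sitePercolation_real_image_relabel triConj p E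
    _ ≤ _ := hE'

/-- **Upper half, probability form, for site sets placed relative to the conjugate rectangle.**
[cite: BollobasRiordan2006, Ch. 7 Claim 20 p. 192 and remark p. 195] -/
theorem cell_le_real_not_pathIn_conj {ρ : ℝ} (hρ : 0 < ρ) :
    ∃ δ₀ > 0, ∃ t₀ > 0, ∀ δ t : ℝ, 0 < δ → δ < δ₀ → 0 ≤ t → t ≤ t₀ →
      ∀ (p : unitInterval) (V U₁ U₃ : Set (Site 2)),
        (∀ x ∈ V, triMeshPoint δ x ∉ W.conjugate.carrier →
          infDist (triMeshPoint δ x) (W.conjugate.arc 1) ≤ t ∨ infDist (triMeshPoint δ x) (W.conjugate.arc 3) ≤ t) →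
        (∀ x ∈ V, triMeshPoint δ x ∈ W.conjugate.carrier →
          8 * δ < infDist (triMeshPoint δ x) (W.conjugate.arc 0) ∧
            8 * δ < infDist (triMeshPoint δ x) (W.conjugate.arc 2)) →
        (∀ x ∈ V, ∀ j : Fin 4, ρ ≤ dist (triMeshPoint δ x) (W.conjugate.pt j)) →
        (∀ u ∈ U₁, 4 * δ ≤ infDist (triMeshPoint δ u) W.conjugate.carrier ∧
          infDist (triMeshPoint δ u) (W.conjugate.arc 1) ≤ t) →
        (∀ v ∈ U₃, 4 * δ ≤ infDist (triMeshPoint δ v) W.conjugate.carrier ∧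
          infDist (triMeshPoint δ v) (W.conjugate.arc 3) ≤ t) →
        (triSitePercolation p).real {ω | Φ ω ∈ discreteCrossing Q.carrier δ (Q.arc 0) (Q.arc 2)} ≤
          (triSitePercolation p).real {ω | ¬ ∃ u ∈ U₁, ∃ v ∈ U₃, PathIn triGraph (V ∩ ωᶜ) u v} := by
  obtain ⟨δ₀, hδ₀, t₀, ht₀, h⟩ := cell_le_real_not_pathIn Φ hΦ g hg Q W hW hWarc hWpt hρ
  refine ⟨δ₀, hδ₀, t₀, ht₀, fun δ t hδ hδlt ht htle p V U₁ U₃ hout hin hcorner hU₁ hU₃ => ?_⟩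
  set E : Set (SiteConfig (Site 2)) := {ω | ¬ ∃ u ∈ triConjFun '' U₁, ∃ v ∈ triConjFun '' U₃,
    PathIn triGraph (triConjFun '' V ∩ ωᶜ) u v} with hE
  -- complement of the image event
  have hsub : {ω : SiteConfig (Site 2) | triConj '' ω ∈ E} ⊆
      {ω | ¬ ∃ u ∈ U₁, ∃ v ∈ U₃, PathIn triGraph (V ∩ ωᶜ) u v} := by
    rintro ω hω ⟨u, hu, v, hv, hP⟩
    refine hω ⟨triConjFun u, mem_image_of_mem _ hu, triConjFun v, mem_image_of_mem _ hv, ?_⟩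
    have := pathIn_image_triConjFun hP
    rwa [image_triConjFun_inter, image_triConjFun_compl] at this
  have hE' : (triSitePercolation p).real {ω | Φ ω ∈ discreteCrossing Q.carrier δ (Q.arc 0) (Q.arc 2)} ≤
      (triSitePercolation p).real E := by
    refine h δ t hδ hδlt ht htle p (triConjFun '' V) (triConjFun '' U₁) (triConjFun '' U₃) ?_ ?_ ?_ ?_ ?_
    · rintro _ ⟨x, hx, rfl⟩ hxW
      rw [infDist_triMeshPoint_triConjFun_arc W, infDist_triMeshPoint_triConjFun_arc W]
      exact hout x hx (fun h' => hxW ((triMeshPoint_triConjFun_mem_iff W δ x).2 h'))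
    · rintro _ ⟨x, hx, rfl⟩ hxW
      rw [infDist_triMeshPoint_triConjFun_arc W, infDist_triMeshPoint_triConjFun_arc W]
      exact hin x hx ((triMeshPoint_triConjFun_mem_iff W δ x).1 hxW)
    · rintro _ ⟨x, hx, rfl⟩ j
      rw [dist_triMeshPoint_triConjFun_pt W]
      exact hcorner x hx j
    · rintro _ ⟨u, hu, rfl⟩
      rw [infDist_triMeshPoint_triConjFun_carrier W, infDist_triMeshPoint_triConjFun_arc W]
      exact hU₁ u hu
    · rintro _ ⟨v, hv, rfl⟩
      rw [infDist_triMeshPoint_triConjFun_carrier W, infDist_triMeshPoint_triConjFun_arc W]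
      exact hU₃ v hv
  calc (triSitePercolation p).real {ω | Φ ω ∈ discreteCrossing Q.carrier δ (Q.arc 0) (Q.arc 2)}
      ≤ (triSitePercolation p).real E := hE'
    _ = (triSitePercolation p).real {ω | triConj '' ω ∈ E} := (sitePercolation_real_image_relabel triConj p E).symm
    _ ≤ _ := measureReal_mono hsub (measure_ne_top _ _)

end Conj

end Summit.CriticalPhenomena.CardyFormulaZ2.Theorems.SmirnovCellAnchor

end
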